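import Mathlib
import Summits.RiemannHypothesis.RiemannHypothesis.Theorems.ScrewManifestCertDefs

/-!
# RH-FREE curvature constraint on manifest certificates (sos-theory g18, 2026-08-26; HOME/sos/lean/ManifestCurvature.lean —
landable verbatim as `Theorems/ScrewManifestCurvature.lean`, `--supports stmt-RiemannHypothesis-15756`)

Every entry of the manifest remainder `R = S_M − Σ w_k A_{t_k} − wJ·J` is `R i j = η(x_i) + η(x_j) − η(x_i − x_j) − wJ` for the
single even function `η(u) = Ψ(u) − Σ_k w_k (1 − cos(t_k u))/t_k²` (`remainderFn`, `remainder_apply_remainderFn`; the tree's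
`Manifest.remainder_apply` of `ScrewManifestCertDual` is the same identity written with `atomScrew`).  For a node triple `p, q, r`
(pairwise distinct) the DD-dual element «row q: + on (q,p),(q,r); row r: − on (r,p)» gives, for ANY strictly diagonally dominant R,
`0 < R q q + R q p + R q r + R r r − R r p` (`curvature_dual_pos`), and for the remainder this reads (`curvature_constraint`)
`η(x_q − x_p) + η(x_r − x_q) − η(x_r − x_p) < 4·η(x_q) + 2·η(x_r) − 3·wJ` — the cusp defect of Ψ at the triple, net of the atoms'
curvature, is paid by node values and the J-weight.  MEASURED on the ddcone threshold certificates (memo SCREW-P3-HEIGHT-LAW-g18 §3.6):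
`3·wJ ≈ Ψ(δ₊)+Ψ(δ₋)−Ψ(δ₊+δ₋)` at the top triple (ratio 1.00–1.06 for M = 32…128), i.e. `wJ·M ≈ (log 2)/3`.
RH-FREE: statements about the certificate FORMAT; nothing here bears on the truth of RH.
-/

-- `Summit.RiemannHypothesis.RiemannHypothesis.…` duplicates `RiemannHypothesis` BY DESIGN (D-0017).
set_option linter.dupNamespace false
set_option autoImplicit false

namespace Summit.RiemannHypothesis.RiemannHypothesis.Theorems.IntegerScrew.Manifest

open Literature.NumberTheory.LFunctions Matrix Finset

/-- RH-FREE. The profile function of a wave decomposition: `η(u) = Ψ(u) − Σ_k w_k (1 − cos(t_k u))/t_k²`. -/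
noncomputable def remainderFn (K : ℕ) (t w : Fin K → ℝ) (u : ℝ) : ℝ :=
  zetaScrew u - ∑ k, w k * ((1 - Real.cos (t k * u)) / t k ^ 2)

/-- `η(0) = 0` (since `Ψ(0) = 0` and every atom profile vanishes at `0`). -/
theorem remainderFn_zero (K : ℕ) (t w : Fin K → ℝ) : remainderFn K t w 0 = 0 := by
  simp [remainderFn, zetaScrew_zero]

/-- `η` is even (since `Ψ` and `cos` are). -/
theorem remainderFn_neg (K : ℕ) (t w : Fin K → ℝ) (u : ℝ) : remainderFn K t w (-u) = remainderFn K t w u := by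
  simp [remainderFn, zetaScrew_neg, mul_neg, Real.cos_neg]

/-- RH-FREE. Every remainder entry is a screw-type kernel of the single function `remainderFn`. -/
theorem remainder_apply_remainderFn (n K : ℕ) (t w : Fin K → ℝ) (wJ : ℝ) (i j : Fin n) :
    remainder n K t w wJ i j
      = remainderFn K t w (node n i) + remainderFn K t w (node n j)
          - remainderFn K t w (node n i - node n j) - wJ := by
  have hS : screwMatrix n i j
      = zetaScrew (node n i) + zetaScrew (node n j) - zetaScrew (node n i - node n j) := rfl
  simp only [remainder, Matrix.sub_apply, Matrix.smul_apply, Matrix.sum_apply, onesMat, waveAtom,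
    Matrix.of_apply, smul_eq_mul, mul_one, hS, remainderFn]
  have h3 : ∑ k, w k * ((1 - Real.cos (t k * node n i) - Real.cos (t k * node n j)
              + Real.cos (t k * (node n i - node n j))) / t k ^ 2)
      = ∑ k, w k * ((1 - Real.cos (t k * node n i)) / t k ^ 2)
        + ∑ k, w k * ((1 - Real.cos (t k * node n j)) / t k ^ 2)
        - ∑ k, w k * ((1 - Real.cos (t k * (node n i - node n j))) / t k ^ 2) := by
    rw [← Finset.sum_add_distrib, ← Finset.sum_sub_distrib]
    refine Finset.sum_congr rfl fun k _ => ?_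
    ring
  rw [h3]; ring

/-- RH-FREE. The curvature DD-dual element: for ANY strictly diagonally dominant `R` and pairwise distinct `p q r`,
`0 < R q q + R q p + R q r + R r r − R r p` (rows `q` and `r` only). -/
theorem curvature_dual_pos {n : ℕ} (R : Matrix (Fin n) (Fin n) ℝ) (hR : IsStrictDiagDominant R)
    (p q r : Fin n) (hpq : p ≠ q) (hqr : q ≠ r) (hpr : p ≠ r) :
    0 < R q q + R q p + R q r + R r r - R r p := by
  have hq := hR q
  have hr := hR r
  have h2 : |R q p| + |R q r| ≤ ∑ j ∈ univ.erase q, |R q j| := by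
    rw [← Finset.sum_pair (f := fun j => |R q j|) hpr]
    apply Finset.sum_le_sum_of_subset_of_nonneg
    · intro j hj
      simp only [Finset.mem_insert, Finset.mem_singleton] at hj
      rcases hj with rfl | rfl
      · exact mem_erase.mpr ⟨hpq, mem_univ _⟩
      · exact mem_erase.mpr ⟨hqr.symm, mem_univ _⟩
    · intro j _ _; exact abs_nonneg _
  have h1 : |R r p| ≤ ∑ j ∈ univ.erase r, |R r j| :=
    single_le_sum (f := fun j => |R r j|) (fun _ _ => abs_nonneg _) (mem_erase.mpr ⟨hpr, mem_univ _⟩)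
  have a1 : -|R q p| ≤ R q p := neg_abs_le _
  have a2 : -|R q r| ≤ R q r := neg_abs_le _
  have a3 : R r p ≤ |R r p| := le_abs_self _
  linarith

/-- RH-FREE. The curvature constraint on manifest remainders: for a strictly DD remainder and a node triple `p, q, r`,
the second difference of the profile at the triple is paid by node values and the J-weight:
`η(x_q − x_p) + η(x_r − x_q) − η(x_r − x_p) < 4η(x_q) + 2η(x_r) − 3wJ`. -/
theorem curvature_constraint (n K : ℕ) (t w : Fin K → ℝ) (wJ : ℝ)
    (hR : IsStrictDiagDominant (remainder n K t w wJ))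
    (p q r : Fin n) (hpq : p ≠ q) (hqr : q ≠ r) (hpr : p ≠ r) :
    remainderFn K t w (node n q - node n p) + remainderFn K t w (node n r - node n q)
        - remainderFn K t w (node n r - node n p)
      < 4 * remainderFn K t w (node n q) + 2 * remainderFn K t w (node n r) - 3 * wJ := by
  have h := curvature_dual_pos _ hR p q r hpq hqr hpr
  rw [remainder_apply_remainderFn, remainder_apply_remainderFn, remainder_apply_remainderFn,
    remainder_apply_remainderFn, remainder_apply_remainderFn] at h
  have e1 : remainderFn K t w (node n q - node n q) = 0 := by rw [sub_self, remainderFn_zero]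
  have e2 : remainderFn K t w (node n r - node n r) = 0 := by rw [sub_self, remainderFn_zero]
  have e3 : remainderFn K t w (node n q - node n r) = remainderFn K t w (node n r - node n q) := by
    rw [← remainderFn_neg, neg_sub]
  linarith

/-- RH-FREE corollary in certificate form: a manifest certificate forces the curvature constraint at every node triple. -/
theorem curvature_constraint_of_cert (n K : ℕ) (t w : Fin K → ℝ) (wJ : ℝ)
    (hR : IsStrictDiagDominant (remainder n K t w wJ)) (q : ℕ) (hq : q + 2 < n) :
    remainderFn K t w (node n ⟨q + 1, by omega⟩ - node n ⟨q, by omega⟩)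
        + remainderFn K t w (node n ⟨q + 2, hq⟩ - node n ⟨q + 1, by omega⟩)
        - remainderFn K t w (node n ⟨q + 2, hq⟩ - node n ⟨q, by omega⟩)
      < 4 * remainderFn K t w (node n ⟨q + 1, by omega⟩) + 2 * remainderFn K t w (node n ⟨q + 2, hq⟩) - 3 * wJ :=
  curvature_constraint n K t w wJ hR ⟨q, by omega⟩ ⟨q + 1, by omega⟩ ⟨q + 2, hq⟩
    (by simp [Fin.ext_iff]) (by simp [Fin.ext_iff]) (by simp [Fin.ext_iff])

end Summit.RiemannHypothesis.RiemannHypothesis.Theorems.IntegerScrew.Manifest
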